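import Summits.BirchSwinnertonDyer.BirchSwinnertonDyer.Theorems.KatoDescentTamePotSupersingularTameUpperLayerZeroDoorsSplitG9
import Summits.BirchSwinnertonDyer.BirchSwinnertonDyer.Theorems.KatoDescentTamePotSupersingularTameUpperUnitTwistRecordsFlat37
import HarnessLib

/-!
# Route `KatoDescentTamePotSupersingular` (rung K8, sub-rung B4 (t′), cell `bsd-potss`): U₀ RECORD at `p = 5` FROM THE LAYER-0 ISOTYPIC INPUT (c2*)₀
# for the `5S4` row 129600gm1, where BOTH the μ-road class-number input and the rank-equality road are shut

Seat `bsd-potss-k8t-c4` g26; `--supports stmt-BirchSwinnertonDyer-19982 --as helper`. THEOREMS ONLY (no definition, no named fact, no `sorry`);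
nothing booked; (A), Conjecture A and BSD are proved for NO curve here; items 19202 / 19982 stay OPEN at class level.

129600gm1 @ 5 (image `G₉` = `5S4`): `rank_5 Cl(ℚ(P)) = 1 > rank_5 Cl(ℚ(x(P))) = 0` (`h(ℚ(P)) = 40` [GRH], `h(ℚ(x(P))) = 4` [CERT], kit j333564), so the
rank-equality road is shut.  Eigenvalue test (kit j334494): the automorphism `P ↦ 2P` of `ℚ(P)` (`Stab(P) = ⟨diag(1,2)⟩`, the coset of `diag(2,1)`) acts
on `Cl(ℚ(P))[5] ≅ 𝔽₅` by `3 ≠ 2`; on the `Stab(P)`-fixed line of `E[5]` it acts by `2`, so the `5`-class of `ℚ(E[5])` is NOT `E[5]`-isotypic and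
(c2*)₀ «`Hom_{Γ_ℚ}(Cl(𝓞_{ℚ(E[5])}), E[5]) = 0`» holds numerically (GRH for the degree-24 class group).  The record displays `h0` = (c2*)₀ and the inertia
input `hcI : σ̄_w² ∈ I(𝔮|5)` (numerically: every prime of `ℚ(x(E[5]))` above `5` ramifies in `ℚ(E[5])`, kit j334018), plus the `G₉` data and
`hKatoA hGZK hmod`; door `TameRankEqRecords.missingUpperBoundAt_five_tame_of_zywinaG9Basis_of_homTrivial_layerZero` (k8t-c4 g26).  (For the other shut
`5S4` rows 110450bj1, 259200gq1, 259200h1 and the shut `5Ns` rows 235200xb1, 338800ex1 the eigenvalue is `2`: for `5Ns` this IDENTIFIES the class as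
`E[5]`-isotypic — (c2*)₀ fails at layer 0 there; for `5S4` it is ambiguous.)  CONDITIONAL; per row; nothing booked; BSD for no curve.

References: [Kato2004Asterisque] Thm. 14.5 (3); [CoatesSujatha2005] Thm. 3.4; [DeoRaySujatha2023] Thm. 3.8; [Zywina2015] §1.3; [Cremona2006] Table 1.
-/

set_option autoImplicit false
-- the Theorems directory repeats the summit name (`Summits/BirchSwinnertonDyer/BirchSwinnertonDyer/…`): house rule of the cell
set_option linter.dupNamespace false

noncomputable section

open scoped Classical NumberField Matrix
open WeierstrassCurve Field IntermediateField
  Literature.NumberTheory.EllipticCurves Literature.NumberTheory.EllipticCurves.Rank1Residual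
  Literature.NumberTheory.EllipticCurves.Rank1Residual.Typed
  Literature.NumberTheory.GaloisRepresentations Literature.NumberTheory.SerreUniformity
  Literature.NumberTheory.IwasawaTheory Literature.NumberTheory.NumberFields Literature.NumberTheory.EllipticCurves.Zywina2015G9
  Summit.BirchSwinnertonDyer.Rank1Residual Summit.BirchSwinnertonDyer.Rank1Residual.Additive
  Summit.BirchSwinnertonDyer.BirchSwinnertonDyer.Theorems

namespace Summit.BirchSwinnertonDyer.BirchSwinnertonDyer.Theorems.TameRankEqRecords

/-! ### `129600gm1` @ `p = 5` — `N = 129600 = 2^6·3^4·5^2`; Cremona: `r_an = 0`; (t′) at `5` (Kodaira II, e = 6); ♭; image `G₉` (`5S4`, displayed). -/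

/-- **CONDITIONAL U₀ for `129600gm1` @ 5 FROM THE LAYER-0 ISOTYPIC INPUT** — `ord₅ #Ш(E) ≤ ord₅ #Ш_an(E)` (`MissingUpperBoundAt E 5`) for
`E = 129600gm1 = [0, 0, 0, -2700, 49680]` (`N = 2^6·3^4·5^2`), from: the named facts `hKatoA hGZK hmod`; Cremona's `r_an = 0` (`hr`); the `G₉` data (`e he σw hσw`,
displayed); the inertia input `hcI : σ̄_w² ∈ I(𝔮|5)` (displayed; kit j334018); the layer-0 isotypic input `h0` (displayed; numerically the `5`-class of
`ℚ(E[5])` has eigenvalue `3 ≠ 2` under `P ↦ 2P`, kit j334494, so it is not `E[5]`-isotypic).  NO `μ`-hypothesis, no class-number equality.  KERNEL: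
`E[5]` irreducible, `Addv`, `SubTprime` (tree: `TameUpperUnitTwistRecords.irr_g129600gm1_5`, `addv_g129600gm1_5`, `subTprime_g129600gm1_5`).  Per row; CONDITIONAL; nothing booked; BSD is not
proved by this. [cite: Kato2004Asterisque, Thm. 14.5 (3) (p. 236)] [cite: CoatesSujatha2005, §3 Thm. 3.4] [cite: Zywina2015, §1.3]
[cite: Cremona2006, Table 1 (Cremona label 129600gm1)] -/
theorem missingUpperBoundAt_g129600gm1_5_of_homTrivial_layerZero
    (hKatoA : Kato2004.rankZero_padicValNat_sha_add_padicValNat_tamagawa_le_of_additive_potGood_of_irreducible_of_fineSelmerDual_fg)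
    (hGZK : rank_eq_analyticRank_of_analyticRank_le_one) (hmod : hasEntireLFunction_rat)
    {W : WeierstrassCurve ℚ} [W.IsElliptic] [W.IsGloballyMinimal] (hWeq : W = (⟨0, 0, 0, (-2700), 49680⟩ : WeierstrassCurve ℚ))
    (hr : W.analyticRank = 0)
    (e : W.geomTorsion (5 : ℕ) ≃+ (Fin 2 → ZMod 5))
    (he : ∀ σ : absoluteGaloisGroup ℚ, ∃ M ∈ G9, ∀ P : W.geomTorsion (5 : ℕ),
      e (σ • P) = ((M : GL (Fin 2) (ZMod 5)) : Matrix (Fin 2) (Fin 2) (ZMod 5)) *ᵥ e P)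
    (σw : absoluteGaloisGroup ℚ) (hσw : ∀ P : W.geomTorsion (5 : ℕ), e (σw • P) = !![0, 4; 1, 0] *ᵥ e P)
    (hcI : ∀ (𝔮 : Ideal (𝓞 ↥(W.divisionField 5))) [𝔮.IsMaximal], ((5 : ℕ) : 𝓞 ↥(W.divisionField 5)) ∈ 𝔮 →
      absRestrictNormalHom (W.divisionField 5) (σw ^ 2) ∈ 𝔮.inertia _)
    (h0 : ∀ μ : Additive (ClassGroup (𝓞 ↥(W.divisionField 5))) →+ W.geomTorsion (5 : ℕ),
      (∀ (τ : absoluteGaloisGroup ℚ) (c : ClassGroup (𝓞 ↥(W.divisionField 5))),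
        μ (Additive.ofMul (ClassGroup.mulEquiv
          (AmbiguousClass.intAut (absRestrictNormalHom (W.divisionField 5) τ)) c)) = τ • μ (Additive.ofMul c)) → μ = 0) :
    MissingUpperBoundAt W 5 := by
  subst hWeq
  exact missingUpperBoundAt_five_tame_of_zywinaG9Basis_of_homTrivial_layerZero _ hKatoA hGZK hmod hr
    TameUpperUnitTwistRecords.addv_g129600gm1_5 TameUpperUnitTwistRecords.subTprime_g129600gm1_5 TameUpperUnitTwistRecords.irr_g129600gm1_5
    e he σw hσw hcI h0

end Summit.BirchSwinnertonDyer.BirchSwinnertonDyer.Theorems.TameRankEqRecords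

end
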